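import Mathlib
import Literature.MathematicalPhysics.QuantumFieldTheory.MagnenRivasseauSeneor1993.MRS93CurvatureDecomposition
import HarnessLib

/-!
# Magnen–Rivasseau–Sénéor (CMP 155, 1993): the INFINITESIMAL and TRUNCATED gauge transformations (II.5)–(II.6)
# typed pointwise on jets, and the two sentences they serve KERNEL-CHECKED — «This action is invariant under the
# gauge transformations» (p.329 tl.4, to first order: the engine of the Ward/Slavnov equation (VIII.2), p.377
# tl.22–23 «by (infinitesimal) gauge invariance, there is no first order dependence in γ») and «the fact that
# A_m D_m = A_m ∂/∂x^m» (p.377 tl.26, the step (VIII.2) → (VIII.3)); (v1.1) (II.32a)–(II.32c) (transformation of a sum =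
# transformation + rotation) and p.341 «A′ = A^{γ,2} = T(γ).A + U(γ)», «A = T⁻¹(A′ − U)» on the tree's (II.41)–(II.42)

statement-level skeleton of published definitions with citation tags; bookkeeping proved; nothing here is a claim
about the Yang–Mills mass gap, about continuum Yang–Mills on `T⁴` without infrared cutoff, or about the Clay problem —
and nothing of Magnen–Rivasseau–Sénéor's analysis is asserted or formalised

**Citation header (reproduction of PUBLISHED work).** J. Magnen, V. Rivasseau, R. Sénéor, *Construction of YM₄ with
an infrared cutoff*, Commun. Math. Phys. **155** (1993) 325–383 [MagnenRivasseauSeneor1993], Sect. II.A p.328 tl.26–29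
(covariant derivative), p.329 tl.2–19 ((II.3)–(II.6)), and Sect. VIII p.377 tl.22–27 ((VIII.2)–(VIII.3)). Loci
`p.NNN tl.nn` = journal page / text-layer line of the held scan `paper:magnen1993-cmp155-mrs-ym4-infrared-cutoff` (PDF
page = journal page − 324); displays read on the decoded page images (renders of record `run/shared/lean/pub/
lit-balaban/inprint/lit-balaban-p14/renders-cmp155/p04_full_s6.png`, `p05_full_s6.png`, `p53_full_s6.png`). Cell
pub-balaban-gaps, track G3, seat mrs-lit-1 (gen 5); companion prose `run/shared/lean/pub/pub-balaban-gaps/g3/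
MRS-AS-PRINTED.md` §2, §5. Builds on `…MRS93CurvatureDecomposition` (seat mrs-lit-2: the pointwise jets `SectIV.FieldJet`,
the curvature (II.1) `SectIV.curvature`, `FieldJet.add`) and `…MRS93TruncatedGauge` (the printed su(2) bracket
`TruncatedGauge.bracket` = the cross product on `ℝ³`).

**Why this file.** The tree types the finite truncated-gauge MATRICES (II.41)–(II.43) (`…TruncatedGauge`), the zero
modes of the free axial action as linearised gauge modes (`…AxialYMAction` §8), and the Slavnov hierarchy (VIII.4)–
(VIII.6) as predicates (`…SlavnovHierarchy`, `…MainStatement`); the transformations (II.5)–(II.6) themselves and the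
one algebraic fact the whole of Sect. VIII rests on — that `F²` has no first-order variation under `A → A + Dγ` —
were quoted, not typed. Both are pointwise polynomial identities in the values of `A, ∂A, γ, ∂γ, ∂∂γ` at a point
(jets), hence typable and checkable with no position-space or measure-theoretic infrastructure and no reading of
Fourier conventions.

**What the paper prints (verbatim, from the page images).**
* p.328 tl.26–28: *«We write A = Σ_{a=1}^3 A^a t_a, with t_a = (iσ_a/2) … With this convention the covariant
  derivative is D_μ = ∂_μ − λ[A_μ, ·].»*; tl.32–33: *«in the three dimensional su(2) space, the commutator is a wedge
  product: [A^a_μ, A^b_ν] = ε^c_{ab} A^a_μ A^b_ν.»*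
* p.329 tl.2–5: *«F² = F₂ + λF₃ + λ²F₄. (II.3) This action is invariant under the gauge transformations: A → A^g;
  (A^g)_μ = gA_μg⁻¹ + (1/λ)∂_μg · g⁻¹. (II.4)»*
* p.329 tl.6–11: *«In what follows these gauge transformations are limited to a particular topological sector, for
  instance the functions from the compact space to G. It is often useful to consider the infinitesimal gauge
  transformations γ with values in the Lie algebra, which are tangent to the gauge transformations, such that g =
  e^{λγ}; the corresponding formula is: A → A^γ; (A^γ)_μ = A_μ + D_μγ, (II.5) where D = ∂ − λ[A, ·] is the
  covariant derivative.»*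
* p.329 tl.11–19: *«Finally for technical reasons it is also useful to introduce infinitesimal gauge transformations
  which correspond to expanding to a finite order in γ the exponential in (II.4). For instance we are interested in
  the regime where A ≅ λ^{−1/2−ε₁} and γ ≅ λ^{−1/2−ε₂}, where ε₁ and ε₂ are very small and we want to keep all terms
  not small as λ → 0. Then we should define A^{γ,2}_μ = A_μ + D_μγ + λ/2[γ, ∂_μγ]. (II.6) This "truncated" gauge
  transformed configuration A^{γ,2} is a polynomial of second order in γ and its derivatives. We could define
  further expansions of the gauge transformations; with these notations, if g = e^{λγ}, we have A^g = A^{γ,∞} and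
  A^γ = A^{γ,1}.»*
* p.338 tl.39–46 and p.339 tl.2–3: *«A gauge transformation which acts on the sum of two fields can be decomposed into
  a gauge transformation on the first and a rotation on the second: (A + B)^{γ,∞} = A^{γ,∞} + B^{rot γ,∞}. (II.32a) This
  is also true for the truncated versions of the gauge transformations introduced above: (A + B)^{γ,n} = A^{γ,n} +
  B^{rot γ,n}, (II.32b) where the index n means that the gauge transformation for A and the rotation for B are
  truncated at order n. The term B^{rot γ} is the linear part in B of the gauge transformation B^γ. For example
  B^{rot γ,2} = B − λ[B, γ]. (II.32c)»*
* p.341 tl.14–26: *«Remark that this change of variables is one to one … For instance, if we write A′ = A^{γ,2} =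
  T(γ).A + U(γ), with T.A = A − λ[A, γ] and U = ∂γ + 1/2[γ, ∂γ], in su(2) space the matrix of T is T_ab(γ) = δ_ab −
  ε_abc λγ_c. (II.41) Its inverse is T⁻¹_ab = … = δ_ab + H_ab, (II.42) where H is a small matrix; the transformation
  A → A′ is therefore inverted by A = T⁻¹(A′ − U).»* (crops `renders/p17_crop_r1750-2350_s2.png`,
  `p17_crop_r2330-2750_s2.png` in the gen-5 seat folder: the «1/2» of U carries no λ in print.)
* p.377 tl.22–27: *«Then in (VIII.1) we perform a change of variables A → A + Dγ; by (infinitesimal) gauge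
  invariance, there is no first order dependence in γ, which gives the "Ward" or "Slavnov" equation: ⟨(J^a_m(x)
  D^{ab}_m(x) − [∂/∂x⁰ A^a_m · D^{ab}_m ∂/∂x⁰]) e^{J·A}⟩_ax = 0. (VIII.2) Integrating by parts and taking into account
  the fact that A_mD_m = A_m ∂/∂x^m we can rewrite this identity simply as: … (VIII.3)»*

**What is typed here (definitions with bodies; bookkeeping kernel-checked, zero `sorry`, zero named facts).**
* §1 pointwise 2-jets `GaugeJet` of the Lie-algebra valued parameter `γ` (`γ(x)`, `∂_μγ(x)`, `∂_μ∂_νγ(x) ∈ su(2) ≅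
  ℝ³`), the Schwarz condition `GaugeJet.Symm` (`∂_μ∂_νγ = ∂_ν∂_μγ`, i.e. `γ` of class `C²` — a hypothesis where used);
  `FieldJet.smul`; (II.5): `covD` (`D_μγ = ∂_μγ − λ[A_μ, γ]` at the point), `covDDer` (its first derivatives by
  Leibniz, `∂_μ(D_νγ) = ∂_μ∂_νγ − λ[∂_μA_ν, γ] − λ[A_ν, ∂_μγ]`), the 1-jet `covDJet` of `Dγ`, the line `gaugeLine A γ t
  = A + t·Dγ` and **`gaugeInf A γ = A^γ = A + Dγ`**; (II.6): **`gaugeTrunc2 A γ = A^{γ,2} = A + Dγ + (λ/2)[γ, ∂γ]`**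
  (values and first derivatives), with `gaugeTrunc2_val` («A^γ = A^{γ,1}» plus the printed second-order term).
* §2 PROVED, **GAUGE COVARIANCE OF THE CURVATURE TO FIRST ORDER**: `curvature_gaugeLine` — for `γ` with symmetric
  second derivatives, `F_μν(A + tDγ) = F_μν(A) − tλ[F_μν(A), γ] − t²λ[D_μγ, D_νγ]` exactly (all `t, λ, μ, ν`; the
  linear term is the Jacobi identity of the printed wedge product); `curvature_gaugeInf` (`t = 1`).
* §3 PROVED, **«This action is invariant under the gauge transformations» TO FIRST ORDER / «no first order dependence
  in γ»**: `fieldStrengthSq lam J = Σ_{μ,ν,a}(F^a_μν)²` (four times the integrand of (II.2), the expression of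
  `…AxialYMAction` §9); `dot_curvature_bracket_self` (`Σ_a F^a [F, γ]^a = 0`); **`fieldStrengthSq_gaugeLine`**:
  `Σ(F(A + tDγ))² = Σ(F(A))² + t²·R(t)` with `R` an explicit polynomial — NO linear term —, and its calculus face
  **`hasDerivAt_fieldStrengthSq_gaugeLine`**: `d/dt|_{t=0} Σ(F(A + tDγ))² = 0`.
* §4 PROVED, **«the fact that A_mD_m = A_m ∂/∂x^m»** (p.377 tl.26): `dot_covD_eq_dot_der` — `A_μ·(D_μγ) = A_μ·∂_μγ`
  for each `μ` (the dropped term is `A_μ·[A_μ, γ] = 0`), and summed `sum_dot_covD_eq`.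
* §5 (v1.1) **(II.32a)–(II.32c)**: `rotTrunc B γ = B^{rot γ} = B − λ[B, γ]` ((II.32c), as a jet); PROVED `gaugeInf_add`
  (`(A + B)^γ = A^γ + B^{rot γ}`, order 1) and `gaugeTrunc2_add` (`(A + B)^{γ,2} = A^{γ,2} + B^{rot γ,2}`, (II.32b) at
  `n = 2`) as identities of jets (`FieldJet.ext'`, `bracket_add_left`).
* §6 (v1.1) **p.341 tl.19–26 with (II.41)–(II.42)** on the tree's matrices `TruncatedGauge.Tmat`/`TinvMat`: `affineU`
  (`U_μ = ∂_μγ + (λ/2)[γ, ∂_μγ]`); PROVED `gaugeTrunc2_val_eq_Tmat_mulVec_add` («A′ = A^{γ,2} = T(γ).A + U(γ), with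
  T.A = A − λ[A, γ]») and `val_eq_TinvMat_mulVec` («A = T⁻¹(A′ − U)»); PRECISION exhibited: p.341 tl.20 prints «U = ∂γ
  + 1/2[γ, ∂γ]» WITHOUT the `λ` of (II.6) — `affineUPrinted`, `affineU_printed_iff` (with the printed `U` the
  decomposition of the printed (II.6) holds iff `(λ − 1)[γ, ∂_μγ] = 0`), `affineU_sub_printed` (the gap is `((λ −
  1)/2)[γ, ∂_μγ]`); not adjudicated.
* §7 (v1.2) **(II.51)–(II.54) p.343, the APPROXIMATE INVERSE transformations** PROVED on values: `GaugeJet.neg`,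
  `remR` = (II.53) `R_μ(A,γ) = λ²([[A_μ,γ],γ] + ½[[∂_μγ,γ],γ])`, `remR'` = (II.54) `λ²[[B_μ,γ],γ]`;
  **`gaugeTrunc2_gaugeTrunc2_neg_val`** ((II.51) `A_μ = ((A^{+γ,2})^{−γ,2})_μ + R_μ(A,γ)`) and
  **`rotTrunc_rotTrunc_neg_val`** ((II.52) `B_μ = ((B^{rot γ,2})^{rot(−γ),2})_μ + R′_μ(B,γ)`) hold EXACTLY as printed.
* §8 (v1.3) **(II.56)–(II.60) p.343, the re-expansion around γ′** PROVED on values: `GaugeJet.sub`, `remO2` = the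
  printed (II.58) `O(λ²)`, `remS` = (II.57) `S_μ(A′,γ,γ′)`, `remS'` = (II.60) `S′`; **`gaugeTrunc2_val_reexpand`**
  ((II.56) `((A′)^{−γ,2} + R)^{γ′,2} = A′ + D(A′)·(γ′ − γ) + S`, also `_printed` with the literal left-hand side) and
  **`rotTrunc_val_reexpand`** ((II.59)) hold EXACTLY as printed — the `O(λ³)` terms inside (II.58)/(II.60) cancel;
  `remS_self` (`S_μ(A′,γ,γ) = 0`).

**Readings (declared).** (J) JETS: every statement is about the values of the fields and of finitely many of their
derivatives at one point — the position-space identities integrate to the printed statements about `∫_Λ` for smooth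
fields, but no function space, torus or integral is typed here (as in `…CurvatureDecomposition`). (K) The symmetry
of second derivatives of `γ` is carried as the hypothesis `GaugeJet.Symm` (true for `C²` functions; the print's `γ`
are smooth). (T) The wedge-product sign is the print's (`TruncatedGauge.bracket`), as in all MRS files of the tree.

**Honest status / what is NOT claimed.** (II.4) (finite gauge transformations `A^g`, group-valued `g`) and (II.8)
(the path-ordered exponential realising the axial gauge) are QUOTED, not typed: they need `SU(2)`-valued functions
and ordered exponentials, not jets; accordingly «A^g = A^{γ,∞}» is not typed, and the EXACT invariance of the action
under (II.4) is not re-derived (only its first-order = infinitesimal form, which is what (VIII.2) uses). Nothing of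
the functional-integral side of (VIII.1)–(VIII.3) (the change of variables in the measure, the source term `J·Dγ`,
the integration by parts in `x`, the cutoff corrections `δ_N`, `E_N`) is typed — those are `…MainStatement`'s
predicates. The power-counting rationale of (II.6) («keep all terms not small as λ → 0») is quoted, not adjudicated.
Nothing here bears on Bałaban's papers; nothing is continuum YM₄ on `T⁴`, nothing lifts the infrared cutoff,
nothing is Clay.
-/

noncomputable section

namespace Literature.MathematicalPhysics.QuantumFieldTheory.MagnenRivasseauSeneor1993

namespace InfinitesimalGauge

open SectIV TruncatedGauge

/-! ## §1 Jets of `γ`; (II.5) `A^γ = A + Dγ`; (II.6) `A^{γ,2}` -/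

/-- Pointwise 2-jet of the infinitesimal gauge parameter «γ with values in the Lie algebra» (p.329 tl.8): the
values `γ(x)`, `∂_μγ(x)`, `∂_μ∂_νγ(x)` in `su(2) ≅ ℝ³` (colour components).
[cite: MagnenRivasseauSeneor1993, §II.A (II.5) p.329 tl.6–11] -/
structure GaugeJet where
  /-- `γ(x)` -/
  val : Fin 3 → ℝ
  /-- `∂_μγ(x)` -/
  der : Fin 4 → Fin 3 → ℝ
  /-- `∂_μ∂_νγ(x)` -/
  der2 : Fin 4 → Fin 4 → Fin 3 → ℝ

/-- Schwarz symmetry of the second derivatives, `∂_μ∂_νγ = ∂_ν∂_μγ` (holds for `γ ∈ C²`; READING (K)).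
[cite: MagnenRivasseauSeneor1993, §II.A (II.5) p.329] -/
def GaugeJet.Symm (γ : GaugeJet) : Prop := ∀ μ ν, γ.der2 μ ν = γ.der2 ν μ

/-- Scalar multiple of a field jet (values and derivatives scale). [cite: MagnenRivasseauSeneor1993, §II.A (II.5) p.329] -/
def _root_.Literature.MathematicalPhysics.QuantumFieldTheory.MagnenRivasseauSeneor1993.SectIV.FieldJet.smul
    (t : ℝ) (J : FieldJet) : FieldJet where
  val μ := t • J.val μ
  der μ ν := t • J.der μ ν

/-- **(II.5), the covariant derivative of `γ`** at the point: «D = ∂ − λ[A, ·]», `D_μγ = ∂_μγ − λ[A_μ, γ]`.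
[cite: MagnenRivasseauSeneor1993, §II.A p.328 tl.27–28, (II.5) p.329 tl.10–11] -/
def covD (lam : ℝ) (A : FieldJet) (γ : GaugeJet) (μ : Fin 4) : Fin 3 → ℝ :=
  γ.der μ - lam • bracket (A.val μ) γ.val

/-- The first derivatives of `Dγ` at the point (Leibniz rule for the bilinear bracket):
`∂_μ(D_νγ) = ∂_μ∂_νγ − λ[∂_μA_ν, γ] − λ[A_ν, ∂_μγ]`. [cite: MagnenRivasseauSeneor1993, §II.A (II.5) p.329] -/
def covDDer (lam : ℝ) (A : FieldJet) (γ : GaugeJet) (μ ν : Fin 4) : Fin 3 → ℝ :=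
  γ.der2 μ ν - lam • bracket (A.der μ ν) γ.val - lam • bracket (A.val ν) (γ.der μ)

/-- The 1-jet of the vector field `Dγ`. [cite: MagnenRivasseauSeneor1993, §II.A (II.5) p.329] -/
def covDJet (lam : ℝ) (A : FieldJet) (γ : GaugeJet) : FieldJet where
  val μ := covD lam A γ μ
  der μ ν := covDDer lam A γ μ ν

/-- The straight line of configurations `t ↦ A + t·Dγ` through `A` in the direction of the infinitesimal gauge
transformation (the «change of variables A → A + Dγ» of (VIII.1)/(VIII.2) is `t = 1`; «first order dependence in
γ» is the `t`-derivative at `0`). [cite: MagnenRivasseauSeneor1993, (II.5) p.329, (VIII.2) p.377 tl.22–23] -/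
def gaugeLine (lam : ℝ) (A : FieldJet) (γ : GaugeJet) (t : ℝ) : FieldJet :=
  A.add ((covDJet lam A γ).smul t)

/-- **(II.5)** «A → A^γ; (A^γ)_μ = A_μ + D_μγ» as a jet map. [cite: MagnenRivasseauSeneor1993, §II.A (II.5) p.329 tl.10–11] -/
def gaugeInf (lam : ℝ) (A : FieldJet) (γ : GaugeJet) : FieldJet := gaugeLine lam A γ 1

/-- Values of `A^γ`: `A_μ + D_μγ`. [cite: MagnenRivasseauSeneor1993, §II.A (II.5) p.329 tl.10–11] -/
theorem gaugeInf_val (lam : ℝ) (A : FieldJet) (γ : GaugeJet) (μ : Fin 4) :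
    (gaugeInf lam A γ).val μ = A.val μ + covD lam A γ μ := by
  simp [gaugeInf, gaugeLine, FieldJet.add, FieldJet.smul, covDJet]

/-- Values along the line: `A_μ + t·D_μγ`. [cite: MagnenRivasseauSeneor1993, §II.A (II.5) p.329] -/
theorem gaugeLine_val (lam : ℝ) (A : FieldJet) (γ : GaugeJet) (t : ℝ) (μ : Fin 4) :
    (gaugeLine lam A γ t).val μ = A.val μ + t • covD lam A γ μ := rfl

/-- Derivatives along the line: `∂_μA_ν + t·∂_μ(D_νγ)`. [cite: MagnenRivasseauSeneor1993, §II.A (II.5) p.329] -/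
theorem gaugeLine_der (lam : ℝ) (A : FieldJet) (γ : GaugeJet) (t : ℝ) (μ ν : Fin 4) :
    (gaugeLine lam A γ t).der μ ν = A.der μ ν + t • covDDer lam A γ μ ν := rfl

/-- At `t = 0` the line is `A` itself. [cite: MagnenRivasseauSeneor1993, §II.A (II.5) p.329] -/
theorem gaugeLine_zero (lam : ℝ) (A : FieldJet) (γ : GaugeJet) : gaugeLine lam A γ 0 = A := by
  cases A
  simp [gaugeLine, FieldJet.add, FieldJet.smul, covDJet]

/-- **(II.6), the TRUNCATED gauge transformation** «A^{γ,2}_μ = A_μ + D_μγ + λ/2[γ, ∂_μγ]» as a jet map (values, and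
first derivatives by Leibniz: `∂_μ((λ/2)[γ, ∂_νγ]) = (λ/2)([∂_μγ, ∂_νγ] + [γ, ∂_μ∂_νγ])`) — «a polynomial of second
order in γ and its derivatives». [cite: MagnenRivasseauSeneor1993, §II.A (II.6) p.329 tl.16–18] -/
def gaugeTrunc2 (lam : ℝ) (A : FieldJet) (γ : GaugeJet) : FieldJet where
  val μ := A.val μ + covD lam A γ μ + (lam / 2) • bracket γ.val (γ.der μ)
  der μ ν := A.der μ ν + covDDer lam A γ μ ν +
    (lam / 2) • (bracket (γ.der μ) (γ.der ν) + bracket γ.val (γ.der2 μ ν))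

/-- «A^γ = A^{γ,1}» and the second-order term: `A^{γ,2}_μ = (A^γ)_μ + (λ/2)[γ, ∂_μγ]` (values).
[cite: MagnenRivasseauSeneor1993, §II.A (II.6) p.329 tl.16–19] -/
theorem gaugeTrunc2_val (lam : ℝ) (A : FieldJet) (γ : GaugeJet) (μ : Fin 4) :
    (gaugeTrunc2 lam A γ).val μ = (gaugeInf lam A γ).val μ + (lam / 2) • bracket γ.val (γ.der μ) := by
  rw [gaugeInf_val]
  rfl

/-- At `λ = 0` all three transformations reduce to the abelian shift `A_μ + ∂_μγ` (values).
[cite: MagnenRivasseauSeneor1993, §II.A (II.5)–(II.6) p.329] -/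
theorem gaugeTrunc2_val_zero_coupling (A : FieldJet) (γ : GaugeJet) (μ : Fin 4) :
    (gaugeTrunc2 0 A γ).val μ = A.val μ + γ.der μ ∧ (gaugeInf 0 A γ).val μ = A.val μ + γ.der μ := by
  constructor
  · simp [gaugeTrunc2, covD]
  · simp [gaugeInf_val, covD]

/-! ## §2 Gauge covariance of the curvature to first order: `F(A + tDγ) = F − tλ[F, γ] − t²λ[Dγ, Dγ]` -/

/-- Component form of the bracket, for `simp`. [cite: MagnenRivasseauSeneor1993, §II.A p.328 tl.32–33] -/
theorem bracket_apply (X Y : Fin 3 → ℝ) (a : Fin 3) :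
    bracket X Y a = ∑ b, ∑ c, eps a b c * X b * Y c := rfl

/-- **GAUGE COVARIANCE OF (II.1) ALONG THE LINE.** For `γ` with symmetric second derivatives and every `t, λ, μ, ν`:
`F_μν(A + tDγ) = F_μν(A) − tλ[F_μν(A), γ] − t²λ[D_μγ, D_νγ]` — the `t`-linear term `∂_μD_νγ − ∂_νD_μγ − λ[A_μ, D_νγ] −
λ[D_μγ, A_ν]` collapses to `−λ[F_μν, γ]` by the Jacobi identity of the printed wedge product and `∂_μ∂_νγ = ∂_ν∂_μγ`.
[cite: MagnenRivasseauSeneor1993, §II.A (II.1) p.328, (II.4)–(II.5) p.329 tl.4–11] -/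
theorem curvature_gaugeLine (lam : ℝ) (A : FieldJet) {γ : GaugeJet} (hγ : γ.Symm) (t : ℝ) (μ ν : Fin 4) :
    curvature lam (gaugeLine lam A γ t) μ ν =
      curvature lam A μ ν - (t * lam) • bracket (curvature lam A μ ν) γ.val -
        (t ^ 2 * lam) • bracket (covD lam A γ μ) (covD lam A γ ν) := by
  have hs : γ.der2 ν μ = γ.der2 μ ν := hγ ν μ
  ext a
  simp only [curvature, gaugeLine_val, gaugeLine_der, covD, covDDer, hs, Pi.add_apply, Pi.sub_apply,
    Pi.smul_apply, smul_eq_mul, bracket_apply, Fin.sum_univ_three]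
  fin_cases a <;> simp [eps] <;> ring

/-- (II.5) at `t = 1`: `F_μν(A^γ) = F_μν(A) − λ[F_μν(A), γ] − λ[D_μγ, D_νγ]`.
[cite: MagnenRivasseauSeneor1993, §II.A (II.1) p.328, (II.5) p.329] -/
theorem curvature_gaugeInf (lam : ℝ) (A : FieldJet) {γ : GaugeJet} (hγ : γ.Symm) (μ ν : Fin 4) :
    curvature lam (gaugeInf lam A γ) μ ν =
      curvature lam A μ ν - lam • bracket (curvature lam A μ ν) γ.val -
        lam • bracket (covD lam A γ μ) (covD lam A γ ν) := by
  unfold gaugeInf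
  rw [curvature_gaugeLine lam A hγ 1 μ ν]
  simp

/-! ## §3 «This action is invariant under the gauge transformations» to first order — «no first order dependence in γ» -/

/-- The pointwise `Σ_{μ,ν} Σ_a (F^a_μν)²` (four times the integrand `(1/4)Σ_a F^a_μν F^{μν a}` of (II.2); the
expression of `…AxialYMAction` §9). [cite: MagnenRivasseauSeneor1993, §II.A (II.2) p.328 tl.34–35] -/
def fieldStrengthSq (lam : ℝ) (J : FieldJet) : ℝ := ∑ μ, ∑ ν, ∑ a, curvature lam J μ ν a ^ 2

/-- `Σ(F^a_μν)² ≥ 0`. [cite: MagnenRivasseauSeneor1993, §II.A (II.2) p.328] -/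
theorem fieldStrengthSq_nonneg (lam : ℝ) (J : FieldJet) : 0 ≤ fieldStrengthSq lam J :=
  Finset.sum_nonneg fun _ _ => Finset.sum_nonneg fun _ _ => Finset.sum_nonneg fun _ _ => sq_nonneg _

/-- `X · [X, γ] = 0` for the printed wedge product (a triple product with a repeated vector).
[cite: MagnenRivasseauSeneor1993, §II.A p.328 tl.32–33] -/
theorem dot_bracket_self (X Y : Fin 3 → ℝ) : ∑ a, X a * bracket X Y a = 0 := by
  simp only [bracket_apply, Fin.sum_univ_three]
  simp [eps]
  ring

/-- In particular `Σ_a F^a_μν [F_μν, γ]^a = 0`: the curvature is orthogonal to its own infinitesimal rotation.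
[cite: MagnenRivasseauSeneor1993, §II.A (II.4)–(II.5) p.329, (VIII.2) p.377 tl.22–23] -/
theorem dot_curvature_bracket_self (lam : ℝ) (A : FieldJet) (γ : GaugeJet) (μ ν : Fin 4) :
    ∑ a, curvature lam A μ ν a * bracket (curvature lam A μ ν) γ.val a = 0 :=
  dot_bracket_self _ _

/-- Expansion of a square along a parabola in `ℝ³`: `Σ_a (u − s v − r w)_a² = Σu² − 2sΣuv − 2rΣuw + s²Σv² + 2srΣvw + r²Σw²`.
[cite: MagnenRivasseauSeneor1993, §II.A (II.3) p.329 tl.2–3] -/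
theorem sum_sq_sub_sub (u v w : Fin 3 → ℝ) (s r : ℝ) :
    ∑ a, (u - s • v - r • w) a ^ 2 =
      ∑ a, u a ^ 2 - 2 * s * ∑ a, u a * v a - 2 * r * ∑ a, u a * w a + s ^ 2 * ∑ a, v a ^ 2 +
        2 * s * r * ∑ a, v a * w a + r ^ 2 * ∑ a, w a ^ 2 := by
  simp only [Fin.sum_univ_three, Pi.sub_apply, Pi.smul_apply, smul_eq_mul]
  ring

/-- Coefficient of `t²` in `Σ_a(F^a_μν(A + tDγ))²`: `λ²|[F_μν, γ]|² − 2λ F_μν·[D_μγ, D_νγ]`.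
[cite: MagnenRivasseauSeneor1993, §II.A (II.4)–(II.5) p.329, (VIII.2) p.377] -/
def remC0 (lam : ℝ) (A : FieldJet) (γ : GaugeJet) (μ ν : Fin 4) : ℝ :=
  lam ^ 2 * ∑ a, bracket (curvature lam A μ ν) γ.val a ^ 2 -
    2 * lam * ∑ a, curvature lam A μ ν a * bracket (covD lam A γ μ) (covD lam A γ ν) a

/-- Coefficient of `t³`: `2λ² [F_μν, γ]·[D_μγ, D_νγ]`. [cite: MagnenRivasseauSeneor1993, §II.A (II.4)–(II.5) p.329, (VIII.2) p.377] -/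
def remC1 (lam : ℝ) (A : FieldJet) (γ : GaugeJet) (μ ν : Fin 4) : ℝ :=
  2 * lam ^ 2 * ∑ a, bracket (curvature lam A μ ν) γ.val a * bracket (covD lam A γ μ) (covD lam A γ ν) a

/-- Coefficient of `t⁴`: `λ² |[D_μγ, D_νγ]|²`. [cite: MagnenRivasseauSeneor1993, §II.A (II.4)–(II.5) p.329, (VIII.2) p.377] -/
def remC2 (lam : ℝ) (A : FieldJet) (γ : GaugeJet) (μ ν : Fin 4) : ℝ :=
  lam ^ 2 * ∑ a, bracket (covD lam A γ μ) (covD lam A γ ν) a ^ 2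

/-- The remainder polynomial `R(t) = Σ_{μν}(C₀ + tC₁ + t²C₂)` of the first-order invariance statement (explicit).
[cite: MagnenRivasseauSeneor1993, §II.A (II.4)–(II.5) p.329, (VIII.2) p.377] -/
def gaugeRemainder (lam : ℝ) (A : FieldJet) (γ : GaugeJet) (t : ℝ) : ℝ :=
  (∑ μ, ∑ ν, remC0 lam A γ μ ν) + t * (∑ μ, ∑ ν, remC1 lam A γ μ ν) + t ^ 2 * (∑ μ, ∑ ν, remC2 lam A γ μ ν)

/-- One pair of indices: `Σ_a(F^a_μν(A + tDγ))² = Σ_a(F^a_μν(A))² + t²(C₀ + tC₁ + t²C₂)` — the `t`-linear coefficient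
`−2λ Σ_a F^a_μν[F_μν, γ]^a` vanishes. [cite: MagnenRivasseauSeneor1993, §II.A (II.3)–(II.5) p.329, (VIII.2) p.377 tl.22–23] -/
theorem sum_sq_curvature_gaugeLine (lam : ℝ) (A : FieldJet) {γ : GaugeJet} (hγ : γ.Symm) (t : ℝ) (μ ν : Fin 4) :
    ∑ a, curvature lam (gaugeLine lam A γ t) μ ν a ^ 2 =
      ∑ a, curvature lam A μ ν a ^ 2 +
        t ^ 2 * (remC0 lam A γ μ ν + t * remC1 lam A γ μ ν + t ^ 2 * remC2 lam A γ μ ν) := by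
  rw [curvature_gaugeLine lam A hγ t μ ν, sum_sq_sub_sub, dot_curvature_bracket_self]
  unfold remC0 remC1 remC2
  ring

/-- **«THIS ACTION IS INVARIANT UNDER THE GAUGE TRANSFORMATIONS» TO FIRST ORDER — «by (infinitesimal) gauge
invariance, there is no first order dependence in γ»** (p.329 tl.4, p.377 tl.22–23), pointwise: for `γ` with
symmetric second derivatives, `Σ_{μν a}(F^a_μν(A + tDγ))² = Σ_{μν a}(F^a_μν(A))² + t²·R(t)` for every `t` and `λ` —
the `t`-linear coefficient `−2λ Σ F·[F, γ]` VANISHES identically. Integrated over `Λ` this is the first-order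
invariance of `(1/2)∫_Λ F²` that the change of variables `A → A + Dγ` in (VIII.1) exploits.
[cite: MagnenRivasseauSeneor1993, §II.A (II.3)–(II.5) p.329 tl.2–11, (VIII.2) p.377 tl.22–25] -/
theorem fieldStrengthSq_gaugeLine (lam : ℝ) (A : FieldJet) {γ : GaugeJet} (hγ : γ.Symm) (t : ℝ) :
    fieldStrengthSq lam (gaugeLine lam A γ t) =
      fieldStrengthSq lam A + t ^ 2 * gaugeRemainder lam A γ t := by
  unfold fieldStrengthSq gaugeRemainder
  simp_rw [sum_sq_curvature_gaugeLine lam A hγ t]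
  simp only [mul_add, Finset.sum_add_distrib, Finset.mul_sum]

/-- The same at `t = 1`: `Σ(F(A^γ))² − Σ(F(A))² = R(1)`, of SECOND order in `(γ, λ)` jointly — no term linear in `γ`.
[cite: MagnenRivasseauSeneor1993, §II.A (II.5) p.329, (VIII.2) p.377] -/
theorem fieldStrengthSq_gaugeInf (lam : ℝ) (A : FieldJet) {γ : GaugeJet} (hγ : γ.Symm) :
    fieldStrengthSq lam (gaugeInf lam A γ) = fieldStrengthSq lam A + gaugeRemainder lam A γ 1 := by
  unfold gaugeInf
  rw [fieldStrengthSq_gaugeLine lam A hγ 1, one_pow, one_mul]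

/-- A real polynomial `S + t²(C₀ + tC₁ + t²C₂)` has derivative `0` at `t = 0`.
[cite: MagnenRivasseauSeneor1993, (VIII.2) p.377 tl.22–23] -/
theorem hasDerivAt_const_add_sq_mul (S C0 C1 C2 : ℝ) :
    HasDerivAt (fun t : ℝ => S + t ^ 2 * (C0 + t * C1 + t ^ 2 * C2)) 0 0 := by
  have h := (hasDerivAt_const (0 : ℝ) S).add (((hasDerivAt_id' (0 : ℝ)).pow 2).mul
    (((hasDerivAt_const (0 : ℝ) C0).add ((hasDerivAt_id' (0 : ℝ)).mul_const C1)).add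
      (((hasDerivAt_id' (0 : ℝ)).pow 2).mul_const C2)))
  refine (h.congr_of_eventuallyEq (Filter.Eventually.of_forall fun t => ?_)).congr_deriv ?_
  · simp only [Pi.add_apply, Pi.mul_apply, Pi.pow_apply]
  · norm_num

/-- **Calculus face: `d/dt|_{t=0} Σ(F^a_μν(A + tDγ))² = 0`.**
[cite: MagnenRivasseauSeneor1993, §II.A (II.4)–(II.5) p.329 tl.4–11, (VIII.2) p.377 tl.22–23] -/
theorem hasDerivAt_fieldStrengthSq_gaugeLine (lam : ℝ) (A : FieldJet) {γ : GaugeJet} (hγ : γ.Symm) :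
    HasDerivAt (fun t => fieldStrengthSq lam (gaugeLine lam A γ t)) 0 0 := by
  simp_rw [fieldStrengthSq_gaugeLine lam A hγ]
  exact hasDerivAt_const_add_sq_mul _ _ _ _

/-! ## §4 «the fact that A_m D_m = A_m ∂/∂x^m» (p.377 tl.26) -/

/-- **`A_μ · (D_μγ) = A_μ · ∂_μγ`** for each `μ` (no sum): the dropped term is `A_μ · [A_μ, γ] = 0`.
[cite: MagnenRivasseauSeneor1993, §VIII p.377 tl.26] -/
theorem dot_covD_eq_dot_der (lam : ℝ) (A : FieldJet) (γ : GaugeJet) (μ : Fin 4) :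
    ∑ a, A.val μ a * covD lam A γ μ a = ∑ a, A.val μ a * γ.der μ a := by
  have h := dot_bracket_self (A.val μ) γ.val
  simp only [covD, Pi.sub_apply, Pi.smul_apply, smul_eq_mul, mul_sub, Finset.sum_sub_distrib]
  have : ∑ a, A.val μ a * (lam * bracket (A.val μ) γ.val a) = lam * ∑ a, A.val μ a * bracket (A.val μ) γ.val a := by
    rw [Finset.mul_sum]
    exact Finset.sum_congr rfl fun a _ => by ring
  rw [this, h, mul_zero, sub_zero]

/-- Summed over the (spatial or all) indices: `Σ_μ A_μ·D_μγ = Σ_μ A_μ·∂_μγ` — «A_mD_m = A_m ∂/∂x^m».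
[cite: MagnenRivasseauSeneor1993, §VIII p.377 tl.26] -/
theorem sum_dot_covD_eq (lam : ℝ) (A : FieldJet) (γ : GaugeJet) (I : Finset (Fin 4)) :
    ∑ μ ∈ I, ∑ a, A.val μ a * covD lam A γ μ a = ∑ μ ∈ I, ∑ a, A.val μ a * γ.der μ a :=
  Finset.sum_congr rfl fun μ _ => dot_covD_eq_dot_der lam A γ μ

/-! ## §5 (v1.1) (II.32a)–(II.32c) p.338–339: a gauge transformation of a sum = gauge transformation of the first
summand + rotation of the second -/

/-- Two field jets are equal when their values and derivatives are. [cite: MagnenRivasseauSeneor1993, §II.A (II.1) p.328] -/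
theorem _root_.Literature.MathematicalPhysics.QuantumFieldTheory.MagnenRivasseauSeneor1993.SectIV.FieldJet.ext'
    {J K : FieldJet} (hv : ∀ μ, J.val μ = K.val μ) (hd : ∀ μ ν, J.der μ ν = K.der μ ν) : J = K := by
  cases J; cases K
  simp only [SectIV.FieldJet.mk.injEq]
  exact ⟨funext hv, funext fun μ => funext (hd μ)⟩

/-- The bracket is additive in its first slot. [cite: MagnenRivasseauSeneor1993, §II.A p.328 tl.32–33] -/
theorem bracket_add_left (X Y Z : Fin 3 → ℝ) : bracket (X + Y) Z = bracket X Z + bracket Y Z := by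
  ext a
  simp only [bracket_apply, Pi.add_apply, Fin.sum_univ_three]
  ring

/-- **(II.32c)**, «B^{rot γ,2} = B − λ[B, γ]» (p.339 tl.2–3): the ROTATION of the second (background) field — the
linear part in `B` of the gauge transformation, truncated; as a jet (values, and first derivatives by Leibniz:
`∂_μ(B_ν − λ[B_ν, γ]) = ∂_μB_ν − λ[∂_μB_ν, γ] − λ[B_ν, ∂_μγ]`). The same expression serves the orders `n = 1` and
`n = 2` (the order-2 term `(λ/2)[γ, ∂γ]` of (II.6) does not involve the field).
[cite: MagnenRivasseauSeneor1993, §II.C (II.32c) p.339 tl.2–3; p.338 tl.45–46] -/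
def rotTrunc (lam : ℝ) (B : FieldJet) (γ : GaugeJet) : FieldJet where
  val μ := B.val μ - lam • bracket (B.val μ) γ.val
  der μ ν := B.der μ ν - lam • bracket (B.der μ ν) γ.val - lam • bracket (B.val ν) (γ.der μ)

/-- **(II.32b) at order 1 / (II.5) on a sum**: `(A + B)^γ = A^γ + B^{rot γ}` — the covariant derivative
`D_{A+B}γ = D_Aγ − λ[B, γ]` splits the shift between the two summands.
[cite: MagnenRivasseauSeneor1993, §II.C (II.32a)–(II.32c) pp.338–339] -/
theorem gaugeInf_add (lam : ℝ) (A B : FieldJet) (γ : GaugeJet) :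
    gaugeInf lam (A.add B) γ = (gaugeInf lam A γ).add (rotTrunc lam B γ) := by
  refine SectIV.FieldJet.ext' (fun μ => ?_) (fun μ ν => ?_)
  · simp only [gaugeInf, gaugeLine, FieldJet.add, FieldJet.smul, covDJet, covD, rotTrunc, one_smul,
      bracket_add_left]
    ext a
    simp only [Pi.add_apply, Pi.sub_apply, Pi.smul_apply, smul_eq_mul]
    ring
  · simp only [gaugeInf, gaugeLine, FieldJet.add, FieldJet.smul, covDJet, covDDer, rotTrunc, one_smul,
      bracket_add_left]
    ext a
    simp only [Pi.add_apply, Pi.sub_apply, Pi.smul_apply, smul_eq_mul]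
    ring

/-- **(II.32b) at order 2**, «(A + B)^{γ,n} = A^{γ,n} + B^{rot γ,n}» with `n = 2` and (II.32c): `(A + B)^{γ,2} =
A^{γ,2} + (B − λ[B, γ])` as jets. [cite: MagnenRivasseauSeneor1993, §II.C (II.32b)–(II.32c) pp.338–339] -/
theorem gaugeTrunc2_add (lam : ℝ) (A B : FieldJet) (γ : GaugeJet) :
    gaugeTrunc2 lam (A.add B) γ = (gaugeTrunc2 lam A γ).add (rotTrunc lam B γ) := by
  refine SectIV.FieldJet.ext' (fun μ => ?_) (fun μ ν => ?_)
  · simp only [gaugeTrunc2, FieldJet.add, covD, rotTrunc, bracket_add_left]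
    ext a
    simp only [Pi.add_apply, Pi.sub_apply, Pi.smul_apply, smul_eq_mul]
    ring
  · simp only [gaugeTrunc2, FieldJet.add, covDDer, rotTrunc, bracket_add_left]
    ext a
    simp only [Pi.add_apply, Pi.sub_apply, Pi.smul_apply, smul_eq_mul]
    ring

/-! ## §6 (v1.1) p.341 tl.19–26 with (II.41)–(II.42): `A′ = A^{γ,2} = T(γ)·A + U(γ)` and its inversion
`A = T⁻¹(A′ − U)` — on the tree's matrices `TruncatedGauge.Tmat` / `TinvMat` -/

/-- The affine part of `A ↦ A^{γ,2}`: `U_μ(γ) = ∂_μγ + (λ/2)[γ, ∂_μγ]` — the terms of (II.6) that do not contain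
`A`. PRECISION (exhibited below, not adjudicated): p.341 tl.20 PRINTS «U = ∂γ + 1/2[γ, ∂γ]» without the factor `λ`
that (II.6) «A^{γ,2}_μ = A_μ + D_μγ + λ/2[γ, ∂_μγ]» carries; with (II.6) as printed the decomposition `A^{γ,2} = T·A
+ U` forces the `λ` (`gaugeTrunc2_val_eq_Tmat_mulVec_add`, `affineU_printed_iff`).
[cite: MagnenRivasseauSeneor1993, §II.C p.341 tl.19–20, (II.6) p.329] -/
def affineU (lam : ℝ) (γ : GaugeJet) (μ : Fin 4) : Fin 3 → ℝ :=
  γ.der μ + (lam / 2) • bracket γ.val (γ.der μ)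

/-- The affine part AS PRINTED on p.341 tl.20: «U = ∂γ + 1/2[γ, ∂γ]» (no `λ`).
[cite: MagnenRivasseauSeneor1993, §II.C p.341 tl.20] -/
def affineUPrinted (γ : GaugeJet) (μ : Fin 4) : Fin 3 → ℝ :=
  γ.der μ + (1 / 2 : ℝ) • bracket γ.val (γ.der μ)

/-- **p.341 tl.19–20 «A′ = A^{γ,2} = T(γ).A + U(γ), with T.A = A − λ[A, γ]»**, on the tree's (II.41) matrix
`TruncatedGauge.Tmat` (`Tmat_mulVec`: `T.A = A − λ[A, γ]`) and `U = ∂γ + (λ/2)[γ, ∂γ]`: the values of (II.6)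
decompose exactly so, for every `λ`, `γ`, `μ`. [cite: MagnenRivasseauSeneor1993, §II.C p.341 tl.19–22, (II.41) p.341, (II.6) p.329] -/
theorem gaugeTrunc2_val_eq_Tmat_mulVec_add (lam : ℝ) (A : FieldJet) (γ : GaugeJet) (μ : Fin 4) :
    (gaugeTrunc2 lam A γ).val μ = (Tmat lam γ.val).mulVec (A.val μ) + affineU lam γ μ := by
  rw [Tmat_mulVec]
  simp only [gaugeTrunc2, covD, affineU]
  ext a
  simp only [Pi.add_apply, Pi.sub_apply, Pi.smul_apply, smul_eq_mul]
  ring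

/-- **«the transformation A → A′ is therefore inverted by A = T⁻¹(A′ − U)»** (p.341 tl.25–26), with the tree's
(II.42) matrix `TinvMat` (a two-sided inverse of `Tmat` for every real `λ`, `γ`): the values of `A` are recovered
from those of `A′ = A^{γ,2}`. [cite: MagnenRivasseauSeneor1993, §II.C (II.42) p.341 tl.23–26] -/
theorem val_eq_TinvMat_mulVec (lam : ℝ) (A : FieldJet) (γ : GaugeJet) (μ : Fin 4) :
    A.val μ = (TinvMat lam γ.val).mulVec ((gaugeTrunc2 lam A γ).val μ - affineU lam γ μ) := by
  rw [gaugeTrunc2_val_eq_Tmat_mulVec_add, add_sub_cancel_right]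
  exact (mulVec_TinvMat_of_eq lam γ.val (A.val μ) _ rfl).symm

/-- PRECISION on p.341 tl.20: with the affine part AS PRINTED («U = ∂γ + 1/2[γ, ∂γ]», no `λ`) the decomposition
`A^{γ,2} = T·A + U` of the printed (II.6) holds at `μ` IF AND ONLY IF `(λ − 1)[γ, ∂_μγ] = 0` — i.e. only for `λ = 1`
or where `[γ, ∂_μγ]` vanishes: the factor `λ` of (II.6) is dropped in print (the p.340 tl.3–5 convention «we use
simply the notation λ instead of λ_i^t» concerns WHICH coupling, not its omission). Exhibited, not adjudicated.
[cite: MagnenRivasseauSeneor1993, §II.C p.341 tl.20, (II.6) p.329, p.340 tl.3–5] -/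
theorem affineU_printed_iff (lam : ℝ) (A : FieldJet) (γ : GaugeJet) (μ : Fin 4) :
    (gaugeTrunc2 lam A γ).val μ = (Tmat lam γ.val).mulVec (A.val μ) + affineUPrinted γ μ ↔
      (lam - 1) • bracket γ.val (γ.der μ) = 0 := by
  rw [gaugeTrunc2_val_eq_Tmat_mulVec_add]
  constructor
  · intro h
    have h' := congrArg (fun v => (2 : ℝ) • (v - (Tmat lam γ.val).mulVec (A.val μ) - γ.der μ)) h
    simp only [affineU, affineUPrinted, add_sub_cancel_left, smul_smul] at h'
    rw [show (2 : ℝ) * (lam / 2) = lam by ring, show (2 : ℝ) * (1 / 2) = 1 by ring, one_smul] at h'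
    rw [sub_smul, one_smul, h', sub_self]
  · intro h
    rw [sub_smul, one_smul, sub_eq_zero] at h
    simp only [affineU, affineUPrinted]
    congr 1
    rw [show (lam / 2 : ℝ) = (1 / 2) * lam by ring, mul_smul, h]

/-- … in particular at the physical value `λ ≠ 1` of a small coupling the printed `U` and the `U` forced by (II.6)
differ exactly by `((λ − 1)/2)[γ, ∂_μγ]`. [cite: MagnenRivasseauSeneor1993, §II.C p.341 tl.20, (II.6) p.329] -/
theorem affineU_sub_printed (lam : ℝ) (γ : GaugeJet) (μ : Fin 4) :
    affineU lam γ μ - affineUPrinted γ μ = ((lam - 1) / 2) • bracket γ.val (γ.der μ) := by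
  simp only [affineU, affineUPrinted]
  ext a
  simp only [Pi.add_apply, Pi.sub_apply, Pi.smul_apply, smul_eq_mul]
  ring

/-! ## §7 (v1.2) (II.51)–(II.54) p.343: the APPROXIMATE INVERSE of the truncated transformations — applying the
order-2 transformation with `−γ` returns the field up to EXPLICIT `λ²` double commutators (values at the point) -/

/-- The jet of `−γ`. [cite: MagnenRivasseauSeneor1993, (II.51)–(II.52) p.343 tl.10–11] -/
def GaugeJet.neg (γ : GaugeJet) : GaugeJet where
  val := -γ.val
  der μ := -γ.der μ
  der2 μ ν := -γ.der2 μ ν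

/-- **(II.53), `R_μ(A, γ) = λ²([[A_μ, γ], γ] + (1/2)[[∂_μγ, γ], γ])`** (value at the point).
[cite: MagnenRivasseauSeneor1993, (II.53) p.343 tl.12] -/
def remR (lam : ℝ) (A : FieldJet) (γ : GaugeJet) (μ : Fin 4) : Fin 3 → ℝ :=
  lam ^ 2 • (bracket (bracket (A.val μ) γ.val) γ.val + (1 / 2 : ℝ) • bracket (bracket (γ.der μ) γ.val) γ.val)

/-- **(II.54), `R′_μ(A, γ) = λ²[[A_μ, γ], γ]`** (value at the point). [cite: MagnenRivasseauSeneor1993, (II.54) p.343 tl.13] -/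
def remR' (lam : ℝ) (B : FieldJet) (γ : GaugeJet) (μ : Fin 4) : Fin 3 → ℝ :=
  lam ^ 2 • bracket (bracket (B.val μ) γ.val) γ.val

/-- **(II.52) PROVED (values): `B_μ = ((B^{rot γ,2})^{rot(−γ),2})_μ + R′_μ(B, γ)`** — «Instead of using the inverse
transformation T⁻¹ we will use the approximate inverse transformation so that we have polynomial error terms»:
`(B − λ[B,γ]) + λ[B − λ[B,γ], γ] = B − λ²[[B,γ],γ]`, exactly. [cite: MagnenRivasseauSeneor1993, (II.52) p.343 tl.11, (II.54) tl.13, p.343 tl.7–9] -/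
theorem rotTrunc_rotTrunc_neg_val (lam : ℝ) (B : FieldJet) (γ : GaugeJet) (μ : Fin 4) :
    B.val μ = (rotTrunc lam (rotTrunc lam B γ) γ.neg).val μ + remR' lam B γ μ := by
  ext a
  simp only [rotTrunc, GaugeJet.neg, remR', Pi.add_apply, Pi.sub_apply, Pi.smul_apply, Pi.neg_apply, smul_eq_mul,
    bracket_apply, Fin.sum_univ_three]
  fin_cases a <;> simp [eps] <;> ring

/-- **(II.51) PROVED (values): `A_μ = ((A^{+γ,2})^{−γ,2})_μ + R_μ(A, γ)`** with the printed (II.53) — applying (II.6)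
with `−γ` to `A′ = A^{γ,2}` gives `A′ − ∂γ + λ[A′, γ] + (λ/2)[γ, ∂γ] = A − λ²[[A,γ],γ] + (λ²/2)[[γ,∂γ],γ]`, the
first-order terms cancelling exactly («polynomial error terms», p.343 tl.7–9).
[cite: MagnenRivasseauSeneor1993, (II.51) p.343 tl.10, (II.53) tl.12, (II.6) p.329] -/
theorem gaugeTrunc2_gaugeTrunc2_neg_val (lam : ℝ) (A : FieldJet) (γ : GaugeJet) (μ : Fin 4) :
    A.val μ = (gaugeTrunc2 lam (gaugeTrunc2 lam A γ) γ.neg).val μ + remR lam A γ μ := by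
  ext a
  simp only [gaugeTrunc2, covD, GaugeJet.neg, remR, Pi.add_apply, Pi.sub_apply, Pi.smul_apply, Pi.neg_apply,
    smul_eq_mul, bracket_apply, Fin.sum_univ_three]
  fin_cases a <;> simp [eps] <;> ring

/-- The error terms ARE of order `λ²`: at `λ = 0` both vanish and the order-2 maps with `∓γ` are exact inverses on
values. [cite: MagnenRivasseauSeneor1993, (II.51)–(II.54) p.343] -/
theorem remR_zero_coupling (A : FieldJet) (γ : GaugeJet) (μ : Fin 4) : remR 0 A γ μ = 0 ∧ remR' 0 A γ μ = 0 := by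
  simp [remR, remR']

/-! ## §8 (v1.3) (II.56)–(II.60) p.343: re-expanding around `γ′` — the error terms `S_μ(A′_s, γ, γ′)` (II.57) with its
printed `O(λ²)` (II.58) and `S′` (II.60) are EXACT (values at the point) -/

/-- The jet of `γ′ − γ`. [cite: MagnenRivasseauSeneor1993, (II.56) p.343 tl.20] -/
def GaugeJet.sub (γ' γ : GaugeJet) : GaugeJet where
  val := γ'.val - γ.val
  der μ := γ'.der μ - γ.der μ
  der2 μ ν := γ'.der2 μ ν - γ.der2 μ ν

/-- **(II.58), the printed `O(λ²)` of `S_μ`:** `O(λ²) = R − λ[R, γ′] − λ²([[A′_μ, γ], γ′] + (1/2)[[γ, ∂_μγ], γ′])` with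
`R = R_μ(A, γ)` of (II.53) and `A′ = A^{γ,2}` (values). [cite: MagnenRivasseauSeneor1993, (II.58) p.343 tl.22] -/
def remO2 (lam : ℝ) (A : FieldJet) (γ γ' : GaugeJet) (μ : Fin 4) : Fin 3 → ℝ :=
  remR lam A γ μ - lam • bracket (remR lam A γ μ) γ'.val -
    lam ^ 2 • (bracket (bracket ((gaugeTrunc2 lam A γ).val μ) γ.val) γ'.val +
      (1 / 2 : ℝ) • bracket (bracket γ.val (γ.der μ)) γ'.val)

/-- **(II.57), `S_μ(A′, γ, γ′) = +(λ/2){[∂_μ(γ − γ′), γ′] + [γ − γ′, ∂_μγ]} + O(λ²)`** with the printed (II.58) `O(λ²)`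
(values). [cite: MagnenRivasseauSeneor1993, (II.57) p.343 tl.21, (II.58) tl.22] -/
def remS (lam : ℝ) (A : FieldJet) (γ γ' : GaugeJet) (μ : Fin 4) : Fin 3 → ℝ :=
  (lam / 2) • (bracket (γ.der μ - γ'.der μ) γ'.val + bracket (γ.val - γ'.val) (γ.der μ)) + remO2 lam A γ γ' μ

/-- **(II.60), `S′ = R′ − λ[R′, γ′] − λ²[[B′, γ], γ′]`** with `R′ = R′_μ(B, γ)` of (II.54) and `B′ = B^{rot γ,2}` (values).
[cite: MagnenRivasseauSeneor1993, (II.60) p.343 tl.25] -/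
def remS' (lam : ℝ) (B : FieldJet) (γ γ' : GaugeJet) (μ : Fin 4) : Fin 3 → ℝ :=
  remR' lam B γ μ - lam • bracket (remR' lam B γ μ) γ'.val -
    lam ^ 2 • bracket (bracket ((rotTrunc lam B γ).val μ) γ.val) γ'.val

/-- **(II.56) PROVED EXACTLY AS PRINTED (values):** with `A′ = A^{γ,2}` and `A = (A′)^{−γ,2} + R(A, γ)` ((II.51)),
`(((A′)^{−γ,2} + R(A,γ))^{γ′,2})_μ = (A^{γ′,2})_μ = A′_μ + D_μ(A′)·(γ′ − γ) + S_μ(A′, γ, γ′)` where `D_μ(A′)·η = ∂_μη −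
λ[A′_μ, η]` and `S_μ` is (II.57) WITH the printed (II.58) — the `O(λ³)` terms of (II.58) cancel identically.
[cite: MagnenRivasseauSeneor1993, (II.56)–(II.58) p.343 tl.19–22, (II.51) tl.10] -/
theorem gaugeTrunc2_val_reexpand (lam : ℝ) (A : FieldJet) (γ γ' : GaugeJet) (μ : Fin 4) :
    (gaugeTrunc2 lam A γ').val μ =
      (gaugeTrunc2 lam A γ).val μ + covD lam (gaugeTrunc2 lam A γ) (γ'.sub γ) μ + remS lam A γ γ' μ := by
  ext a
  simp only [gaugeTrunc2, covD, GaugeJet.sub, remS, remO2, remR, Pi.add_apply, Pi.sub_apply, Pi.smul_apply,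
    smul_eq_mul, bracket_apply, Fin.sum_univ_three]
  fin_cases a <;> simp [eps] <;> ring

/-- (II.56) with its printed left-hand side: the order-2 transform with `γ′` of the field whose value is
`(A′)^{−γ,2} + R(A, γ)` (any first derivatives — the values of `X^{γ′,2}` depend on `X` only through its values).
[cite: MagnenRivasseauSeneor1993, (II.56) p.343 tl.20, (II.51) tl.10] -/
theorem gaugeTrunc2_val_reexpand_printed (lam : ℝ) (A : FieldJet) (γ γ' : GaugeJet)
    (d : Fin 4 → Fin 4 → Fin 3 → ℝ) (μ : Fin 4) :
    (gaugeTrunc2 lam ⟨fun ν => (gaugeTrunc2 lam (gaugeTrunc2 lam A γ) γ.neg).val ν + remR lam A γ ν, d⟩ γ').val μ =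
      (gaugeTrunc2 lam A γ).val μ + covD lam (gaugeTrunc2 lam A γ) (γ'.sub γ) μ + remS lam A γ γ' μ := by
  have h : (fun ν => (gaugeTrunc2 lam (gaugeTrunc2 lam A γ) γ.neg).val ν + remR lam A γ ν) = A.val :=
    funext fun ν => (gaugeTrunc2_gaugeTrunc2_neg_val lam A γ ν).symm
  rw [← gaugeTrunc2_val_reexpand lam A γ γ' μ, h]
  rfl

/-- **(II.59) PROVED EXACTLY AS PRINTED (values):** with `B′ = B^{rot γ,2}` and `B = (B′)^{rot(−γ),2} + R′` ((II.52)),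
`(((B′)^{rot −γ,2} + R′)^{rot γ′,2})_μ = (B^{rot γ′,2})_μ = ((B′)^{rot(γ′−γ),2})_μ + S′` with the printed (II.60) `S′`.
[cite: MagnenRivasseauSeneor1993, (II.59)–(II.60) p.343 tl.24–25, (II.52) tl.11] -/
theorem rotTrunc_val_reexpand (lam : ℝ) (B : FieldJet) (γ γ' : GaugeJet) (μ : Fin 4) :
    (rotTrunc lam B γ').val μ = (rotTrunc lam (rotTrunc lam B γ) (γ'.sub γ)).val μ + remS' lam B γ γ' μ := by
  ext a
  simp only [rotTrunc, GaugeJet.sub, remS', remR', Pi.add_apply, Pi.sub_apply, Pi.smul_apply, smul_eq_mul,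
    bracket_apply, Fin.sum_univ_three]
  fin_cases a <;> simp [eps] <;> ring

/-- (II.59) with its printed left-hand side. [cite: MagnenRivasseauSeneor1993, (II.59) p.343 tl.24, (II.52) tl.11] -/
theorem rotTrunc_val_reexpand_printed (lam : ℝ) (B : FieldJet) (γ γ' : GaugeJet)
    (d : Fin 4 → Fin 4 → Fin 3 → ℝ) (μ : Fin 4) :
    (rotTrunc lam ⟨fun ν => (rotTrunc lam (rotTrunc lam B γ) γ.neg).val ν + remR' lam B γ ν, d⟩ γ').val μ =
      (rotTrunc lam (rotTrunc lam B γ) (γ'.sub γ)).val μ + remS' lam B γ γ' μ := by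
  have h : (fun ν => (rotTrunc lam (rotTrunc lam B γ) γ.neg).val ν + remR' lam B γ ν) = B.val :=
    funext fun ν => (rotTrunc_rotTrunc_neg_val lam B γ ν).symm
  rw [← rotTrunc_val_reexpand lam B γ γ' μ, h]
  rfl

/-- Consistency check of (II.57)/(II.58): at `γ′ = γ` nothing is re-expanded, `D(A′)·0 = 0`, and (II.56) reads
`A′ = A′ + S_μ(A′, γ, γ)`; hence `S_μ(A′, γ, γ) = 0` — PROVED from (II.56). [cite: MagnenRivasseauSeneor1993, (II.56)–(II.58) p.343] -/
theorem remS_self (lam : ℝ) (A : FieldJet) (γ : GaugeJet) (μ : Fin 4) : remS lam A γ γ μ = 0 := by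
  have h := gaugeTrunc2_val_reexpand lam A γ γ μ
  have h0 : covD lam (gaugeTrunc2 lam A γ) (γ.sub γ) μ = 0 := by
    ext a
    simp [covD, GaugeJet.sub, bracket_apply]
  rw [h0, add_zero] at h
  exact (add_eq_left.mp h.symm)

end InfinitesimalGauge

end Literature.MathematicalPhysics.QuantumFieldTheory.MagnenRivasseauSeneor1993
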